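import Summits.QuantumFields.YangMills.Theorems.SmallFieldWideningWindowCondCauchyCouplingPos

/-!
# Route SmallFieldWidening, crux `WindowCondCauchy` (stmt-QuantumFields-27825), line «via-tv» — THE COUPLING DOOR IS
# EQUIVALENT TO THE INCREMENT DOOR: maximal coupling of the conditioned unit laws

LINE g6-C «Cauchy door» (planner ym-idea-1 g6; critic idea-crit-4 g4 notes n2/n5).  The one open stub of «via-tv» v2 is
`WindowCondCauchyCoupling.OneStepCoupling` (p635469): PROBABILITY COUPLINGS `π_K` of the conditioned unit laws `ν_K = condUnitLaw … K`,
`ν_{K+1}` with measurable bad sets `B_K ⊇ {u ≠ u'}` of summable mass.  The landed door `summableCondIncrements_of_oneStepCoupling`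
turns such couplings into the v1 increment form «for every measurable unit observable `|W| ≤ 1`,
`|⨍ W ∂win_{K+1} − ⨍ W ∂win_K| ≤ t_K`, `Σ t_K < ∞`» that `WideningSmallFieldCauchy.smallFieldCauchy_of_summable_condIncrements` consumes.
This file proves the CONVERSE, so that the coupling typing asked for by the critic (n2) is NOT a strengthening of the increment
door: whoever supplies the RG content may deliver either currency, with the same `t`.

* §1 (pure measure theory, any measurable space with measurable diagonal) — the MAXIMAL COUPLING in the form the door needs:
  `exists_coupling_of_le_of_le` (a common lower bound `m ≤ μ, ν` of two probability laws gives a probability coupling with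
  off-diagonal mass `≤ 1 − m(univ)`: `π = diag_* m + d⁻¹·(μ − m) ⊗ (ν − m)`), `exists_overlap` (the overlap `μ ∧ ν :=
  (μ+ν).withDensity (min dμ/d(μ+ν), dν/d(μ+ν))` has defect `1 − (μ∧ν)(univ) = μ(A) − ν(A)` on `A = {dν < dμ}`),
  `measureReal_sub_le_of_integral_bound` (the dual bound `|∫W dν − ∫W dμ| ≤ t` over measurable `|W| ≤ 1` gives
  `μ(A) − ν(A) ≤ t/2`), assembled in `exists_coupling_of_integral_bound` (coupling with `π{x ≠ y} ≤ t/2`).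
  A coupling conversely bounds every event increment by twice its bad mass (`abs_measureReal_sub_le_of_coupling`).
* §2 `oneStepCoupling_of_summableCondIncrements` — the converse door (the conditioned laws are probability laws for
  `γ ≤ γ₁(L,b₀,p₀)` by p636825's `isProbabilityMeasure_condUnitLaw`; the unit field space `SU(2)^{bonds}` is second countable
  Hausdorff with its Borel σ-algebra, so the diagonal is measurable), and `oneStepCoupling_iff_summableCondIncrements`.
* §3 `oneStepCoupling_iff_summableEventIncrements` — the same in the plain total-variation currency: for small `γ`, summable `t`
  with `|ν_{K+1}(A) − ν_K(A)| ≤ t_K` for every measurable unit event `A`.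
* §4 THE DOOR LATTICE: the registered stub of «via-tilt» (= crux r2 `AllHeightsSmallTilt`, an all-heights TILT of summable radii)
  IMPLIES the registered stub of «via-tv» (`summableCondIncrements_of_allHeightsSmallTilt`, `oneStepCoupling_of_allHeightsSmallTilt`:
  `t_K = 8 r_K` by the landed `abs_integral_normalize_sub_le_of_isTilt` in the junk-guard range) — so
  `AllHeightsSmallTilt ⇒ OneStepCoupling ⇒ WindowCondCauchy`: «via-tv» is the WEAKER door, as the planner's card says.

Nothing here is the RG content (`OneStepCoupling` stays OPEN); no estimate of Bałaban's is asserted; no summit statement is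
touched (R3 is a RECORD rung of LADDER-YM; the Yang–Mills mass gap is NOT proved by any of this).
-/

set_option autoImplicit false
open MeasureTheory Set
open Literature.MathematicalPhysics.QuantumFieldTheory.Balaban1983to89
open Literature.MathematicalPhysics.QuantumFieldTheory.Balaban1983to89.Missing
open Literature.MathematicalPhysics.QuantumFieldTheory.Balaban1983to89.T3ContinuumYM3Torus
open Literature.MathematicalPhysics.QuantumFieldTheory.Balaban1983to89.T3UnitLawDensityEML (ℰp measurableE_ℰp)
open Literature.MathematicalPhysics.QuantumFieldTheory.Balaban1983to89.T3UnitScaleTilt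

namespace Summit.QuantumFields.YangMills.Theorems.WindowCondCauchyCoupling

/-! ## §1 Pure measure theory: the maximal coupling -/

section Coupling

variable {X : Type*} [MeasurableSpace X]

/-- **COUPLING FROM A COMMON LOWER BOUND.**  If `m ≤ μ` and `m ≤ ν` for probability laws `μ`, `ν` on a space with measurable
diagonal, then `π := diag_* m + d⁻¹ · (μ − m) ⊗ (ν − m)`, `d = 1 − m(univ)` (and `π := diag_* μ` when `d = 0`), is a probability
coupling of `μ` and `ν` whose off-diagonal mass is at most `d`. (Maximal-coupling construction; folklore.) -/
theorem exists_coupling_of_le_of_le (hΔ : MeasurableSet (diagonal X)) (μ ν m : Measure X)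
    [IsProbabilityMeasure μ] [IsProbabilityMeasure ν] (hmμ : m ≤ μ) (hmν : m ≤ ν) :
    ∃ π : Measure (X × X), IsProbabilityMeasure π ∧ π.map Prod.fst = μ ∧ π.map Prod.snd = ν ∧
      π (diagonal X)ᶜ ≤ 1 - m univ := by
  haveI : IsFiniteMeasure m := isFiniteMeasure_of_le μ hmμ
  have hdiag : Measurable (fun x : X => (x, x)) := measurable_id.prodMk measurable_id
  have hfst : (Prod.fst ∘ fun x : X => (x, x)) = id := rfl
  have hsnd : (Prod.snd ∘ fun x : X => (x, x)) = id := rfl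
  have hpre : (fun x : X => (x, x)) ⁻¹' (diagonal X)ᶜ = ∅ := by
    ext x
    simp
  have hm1 : m univ ≤ 1 := (Measure.le_iff'.1 hmμ univ).trans_eq measure_univ
  haveI : IsFiniteMeasure (μ - m) := isFiniteMeasure_of_le μ Measure.sub_le
  haveI : IsFiniteMeasure (ν - m) := isFiniteMeasure_of_le ν Measure.sub_le
  have hμ'u : (μ - m) univ = 1 - m univ := by rw [Measure.sub_apply MeasurableSet.univ hmμ, measure_univ]
  have hν'u : (ν - m) univ = 1 - m univ := by rw [Measure.sub_apply MeasurableSet.univ hmν, measure_univ]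
  have hμsum : μ - m + m = μ := Measure.sub_add_cancel_of_le hmμ
  have hνsum : ν - m + m = ν := Measure.sub_add_cancel_of_le hmν
  by_cases hd0 : 1 - m univ = 0
  · -- no defect: `μ = m = ν`, the diagonal coupling
    have hμ'0 : μ - m = 0 := by rw [← Measure.measure_univ_eq_zero, hμ'u, hd0]
    have hν'0 : ν - m = 0 := by rw [← Measure.measure_univ_eq_zero, hν'u, hd0]
    have hμm : μ = m := by rw [← hμsum, hμ'0, zero_add]
    have hνm : ν = m := by rw [← hνsum, hν'0, zero_add]
    refine ⟨μ.map (fun x => (x, x)), Measure.isProbabilityMeasure_map hdiag.aemeasurable, ?_, ?_, ?_⟩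
    · rw [Measure.map_map measurable_fst hdiag, hfst, Measure.map_id]
    · rw [Measure.map_map measurable_snd hdiag, hsnd, Measure.map_id, hνm, hμm]
    · rw [Measure.map_apply hdiag hΔ.compl, hpre, measure_empty]
      exact zero_le
  · -- positive defect `d`: diagonal part `diag_* m` plus the normalised product of the residuals
    have hdtop : 1 - m univ ≠ ⊤ := ne_top_of_le_ne_top ENNReal.one_ne_top tsub_le_self
    have hdd : (1 - m univ)⁻¹ * (1 - m univ) = 1 := ENNReal.inv_mul_cancel hd0 hdtop
    refine ⟨m.map (fun x => (x, x)) + (1 - m univ)⁻¹ • (μ - m).prod (ν - m), ⟨?_⟩, ?_, ?_, ?_⟩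
    · rw [Measure.add_apply, Measure.smul_apply, Measure.map_apply hdiag MeasurableSet.univ, preimage_univ,
        ← univ_prod_univ, Measure.prod_prod, hμ'u, hν'u, smul_eq_mul, ← mul_assoc, hdd, one_mul,
        add_tsub_cancel_of_le hm1]
    · rw [Measure.map_add _ _ measurable_fst, Measure.map_smul, Measure.map_map measurable_fst hdiag, hfst,
        Measure.map_id, Measure.map_fst_prod, hν'u, smul_smul, hdd, one_smul, add_comm, hμsum]
    · rw [Measure.map_add _ _ measurable_snd, Measure.map_smul, Measure.map_map measurable_snd hdiag, hsnd,
        Measure.map_id, Measure.map_snd_prod, hμ'u, smul_smul, hdd, one_smul, add_comm, hνsum]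
    · rw [Measure.add_apply, Measure.smul_apply, Measure.map_apply hdiag hΔ.compl, hpre, measure_empty, zero_add,
        smul_eq_mul]
      calc (1 - m univ)⁻¹ * (μ - m).prod (ν - m) (diagonal X)ᶜ
          ≤ (1 - m univ)⁻¹ * (μ - m).prod (ν - m) univ := by gcongr; exact subset_univ _
        _ = 1 - m univ := by
            rw [← univ_prod_univ, Measure.prod_prod, hμ'u, hν'u, ← mul_assoc, hdd, one_mul]

/-- **THE OVERLAP OF TWO PROBABILITY LAWS.**  With `λ = μ + ν` and the Radon–Nikodym derivatives `f = dμ/dλ`, `g = dν/dλ`, the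
measure `m = λ.withDensity (min f g)` is below both `μ` and `ν`, and its defect is `1 − m(univ) = μ(A) − ν(A)` on the measurable
set `A = {g < f}` (where `ν(A) ≤ μ(A)`). (Folklore: `m = μ ∧ ν`, `1 − ‖μ ∧ ν‖ = ‖μ − ν‖_TV`.) -/
theorem exists_overlap (μ ν : Measure X) [IsProbabilityMeasure μ] [IsProbabilityMeasure ν] :
    ∃ (m : Measure X) (A : Set X), m ≤ μ ∧ m ≤ ν ∧ MeasurableSet A ∧ ν A ≤ μ A ∧ 1 - m univ = μ A - ν A := by
  set lam : Measure X := μ + ν with hlam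
  haveI : IsFiniteMeasure lam := by rw [hlam]; infer_instance
  have hacμ : μ ≪ lam := (Measure.AbsolutelyContinuous.refl μ).add_right ν
  have hacν : ν ≪ lam := by
    rw [hlam, add_comm]
    exact (Measure.AbsolutelyContinuous.refl ν).add_right μ
  set f := μ.rnDeriv lam with hf
  set g := ν.rnDeriv lam with hg
  have hfm : Measurable f := Measure.measurable_rnDeriv μ lam
  have hgm : Measurable g := Measure.measurable_rnDeriv ν lam
  have hμeq : lam.withDensity f = μ := Measure.withDensity_rnDeriv_eq μ lam hacμ
  have hνeq : lam.withDensity g = ν := Measure.withDensity_rnDeriv_eq ν lam hacν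
  have hA : MeasurableSet {x | g x < f x} := measurableSet_lt hgm hfm
  have hleμ : lam.withDensity (fun x => min (f x) (g x)) ≤ μ :=
    calc lam.withDensity (fun x => min (f x) (g x)) ≤ lam.withDensity f :=
          withDensity_mono (ae_of_all _ fun x => min_le_left _ _)
      _ = μ := hμeq
  have hleν : lam.withDensity (fun x => min (f x) (g x)) ≤ ν :=
    calc lam.withDensity (fun x => min (f x) (g x)) ≤ lam.withDensity g :=
          withDensity_mono (ae_of_all _ fun x => min_le_right _ _)
      _ = ν := hνeq
  haveI : IsFiniteMeasure (lam.withDensity fun x => min (f x) (g x)) := isFiniteMeasure_of_le μ hleμ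
  refine ⟨lam.withDensity (fun x => min (f x) (g x)), {x | g x < f x}, hleμ, hleν, hA, ?_, ?_⟩
  · -- `ν(A) = ∫_A g ≤ ∫_A f = μ(A)`
    have hνA : ν {x | g x < f x} = ∫⁻ x in {x | g x < f x}, g x ∂lam := by
      conv_lhs => rw [← hνeq]
      exact withDensity_apply _ hA
    have hμA : μ {x | g x < f x} = ∫⁻ x in {x | g x < f x}, f x ∂lam := by
      conv_lhs => rw [← hμeq]
      exact withDensity_apply _ hA
    rw [hνA, hμA]
    exact setLIntegral_mono hfm fun x hx => le_of_lt hx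
  · -- `m(univ) = ∫_A g + ∫_{Aᶜ} f = ν(A) + μ(Aᶜ)` and `μ(A) + μ(Aᶜ) = 1`
    have hνA : ν {x | g x < f x} = ∫⁻ x in {x | g x < f x}, g x ∂lam := by
      conv_lhs => rw [← hνeq]
      exact withDensity_apply _ hA
    have hμA : μ {x | g x < f x} = ∫⁻ x in {x | g x < f x}, f x ∂lam := by
      conv_lhs => rw [← hμeq]
      exact withDensity_apply _ hA
    have hμAc : μ {x | g x < f x}ᶜ = ∫⁻ x in {x | g x < f x}ᶜ, f x ∂lam := by
      conv_lhs => rw [← hμeq]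
      exact withDensity_apply _ hA.compl
    have hmuniv : lam.withDensity (fun x => min (f x) (g x)) univ = ν {x | g x < f x} + μ {x | g x < f x}ᶜ := by
      rw [withDensity_apply _ MeasurableSet.univ, Measure.restrict_univ,
        ← lintegral_add_compl (fun x => min (f x) (g x)) hA, hνA, hμAc]
      congr 1
      · exact setLIntegral_congr_fun hA fun x hx => min_eq_right (le_of_lt hx)
      · exact setLIntegral_congr_fun hA.compl fun x hx => min_eq_left (not_lt.1 hx)
    have hνle : ν {x | g x < f x} ≤ μ {x | g x < f x} := by
      rw [hνA, hμA]
      exact setLIntegral_mono hfm fun x hx => le_of_lt hx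
    refine ENNReal.sub_eq_of_eq_add (measure_ne_top _ _) ?_
    rw [hmuniv, ← add_assoc, tsub_add_cancel_of_le hνle, measure_add_measure_compl hA, measure_univ]

/-- **TOTAL VARIATION FROM THE DUAL BOUND.**  If `|∫ W dν − ∫ W dμ| ≤ t` for every measurable `W` with `|W| ≤ 1` (probability
laws `μ`, `ν`), then `μ(A) − ν(A) ≤ t/2` for every measurable `A` (test `W = 2·𝟙_A − 1`). (Folklore.) -/
theorem measureReal_sub_le_of_integral_bound (μ ν : Measure X) [IsProbabilityMeasure μ] [IsProbabilityMeasure ν] {t : ℝ}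
    (h : ∀ W : X → ℝ, Measurable W → (∀ x, |W x| ≤ 1) → |(∫ x, W x ∂ν) - ∫ x, W x ∂μ| ≤ t)
    {A : Set X} (hA : MeasurableSet A) : μ.real A - ν.real A ≤ t / 2 := by
  have hWm : Measurable fun x => 2 * A.indicator (1 : X → ℝ) x - 1 :=
    ((measurable_const.indicator hA).const_mul 2).sub measurable_const
  have hWb : ∀ x, |2 * A.indicator (1 : X → ℝ) x - 1| ≤ 1 := by
    intro x
    by_cases hx : x ∈ A
    · rw [indicator_of_mem hx]; norm_num
    · rw [indicator_of_notMem hx]; norm_num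
  have hint : ∀ (ρ : Measure X) [IsProbabilityMeasure ρ],
      ∫ x, (2 * A.indicator (1 : X → ℝ) x - 1) ∂ρ = 2 * ρ.real A - 1 := by
    intro ρ _
    have hi : Integrable (fun x => 2 * A.indicator (1 : X → ℝ) x) ρ :=
      ((integrable_const (1 : ℝ)).indicator hA).const_mul 2
    rw [integral_sub hi (integrable_const _), integral_const_mul, integral_indicator_one hA, integral_const,
      smul_eq_mul, mul_one, probReal_univ]
  have := h _ hWm hWb
  rw [hint ν, hint μ, abs_le] at this
  linarith [this.1, this.2]

/-- ★ **MAXIMAL COUPLING, EVENT FORM.**  On a measurable space with measurable diagonal, two probability laws `μ`, `ν` with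
`μ(A) − ν(A) ≤ δ` for every measurable `A` admit a probability coupling `π` (marginals `μ`, `ν`) with `π{x ≠ y} ≤ δ`.
(Folklore: the maximal coupling achieves the total variation distance.) -/
theorem exists_coupling_of_measureReal_sub_le (hΔ : MeasurableSet (diagonal X)) (μ ν : Measure X)
    [IsProbabilityMeasure μ] [IsProbabilityMeasure ν] {δ : ℝ}
    (h : ∀ A : Set X, MeasurableSet A → μ.real A - ν.real A ≤ δ) :
    ∃ π : Measure (X × X), IsProbabilityMeasure π ∧ π.map Prod.fst = μ ∧ π.map Prod.snd = ν ∧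
      (π (diagonal X)ᶜ).toReal ≤ δ := by
  obtain ⟨m, A, hmμ, hmν, hA, hνμ, hdef⟩ := exists_overlap μ ν
  obtain ⟨π, hπ, h1, h2, hoff⟩ := exists_coupling_of_le_of_le hΔ μ ν m hmμ hmν
  refine ⟨π, hπ, h1, h2, ?_⟩
  have htop : μ A - ν A ≠ ⊤ := ne_top_of_le_ne_top (measure_ne_top μ A) tsub_le_self
  calc (π (diagonal X)ᶜ).toReal ≤ (μ A - ν A).toReal := ENNReal.toReal_mono htop (hoff.trans_eq hdef)
    _ = μ.real A - ν.real A := by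
        rw [ENNReal.toReal_sub_of_le hνμ (measure_ne_top μ A)]
        rfl
    _ ≤ δ := h A hA

/-- ★ **MAXIMAL COUPLING, DUAL FORM.**  On a measurable space with measurable diagonal, two probability laws `μ`, `ν` with
`|∫ W dν − ∫ W dμ| ≤ t` for every measurable `|W| ≤ 1` admit a probability coupling `π` (marginals `μ`, `ν`) with
`π{x ≠ y} ≤ t/2`. (Folklore.) -/
theorem exists_coupling_of_integral_bound (hΔ : MeasurableSet (diagonal X)) (μ ν : Measure X)
    [IsProbabilityMeasure μ] [IsProbabilityMeasure ν] {t : ℝ}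
    (h : ∀ W : X → ℝ, Measurable W → (∀ x, |W x| ≤ 1) → |(∫ x, W x ∂ν) - ∫ x, W x ∂μ| ≤ t) :
    ∃ π : Measure (X × X), IsProbabilityMeasure π ∧ π.map Prod.fst = μ ∧ π.map Prod.snd = ν ∧
      (π (diagonal X)ᶜ).toReal ≤ t / 2 :=
  exists_coupling_of_measureReal_sub_le hΔ μ ν fun _ hA => measureReal_sub_le_of_integral_bound μ ν h hA

/-- **A COUPLING BOUNDS THE EVENT INCREMENTS**: if a probability measure `π` has marginals `μ`, `ν` and a measurable bad set
`B ⊇ {x ≠ y}`, then `|ν(A) − μ(A)| ≤ 2·π(B)` for every measurable `A` (the sibling file's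
`abs_average_sub_average_le_of_coupling` at `W = 𝟙_A`; the factor `2` is immaterial here). -/
theorem abs_measureReal_sub_le_of_coupling (μ ν : Measure X) (π : Measure (X × X)) (B : Set (X × X))
    [IsProbabilityMeasure μ] [IsProbabilityMeasure ν] [IsProbabilityMeasure π]
    (h1 : π.map Prod.fst = μ) (h2 : π.map Prod.snd = ν) (hB : MeasurableSet B) (hBd : ∀ p, p ∉ B → p.1 = p.2)
    {A : Set X} (hA : MeasurableSet A) : |ν.real A - μ.real A| ≤ 2 * (π B).toReal := by
  have h1' : π.map Prod.fst = (μ univ)⁻¹ • μ := by rw [h1, measure_univ, inv_one, one_smul]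
  have h2' : π.map Prod.snd = (ν univ)⁻¹ • ν := by rw [h2, measure_univ, inv_one, one_smul]
  have hb : ∀ x, |A.indicator (1 : X → ℝ) x| ≤ 1 := by
    intro x
    by_cases hx : x ∈ A
    · rw [indicator_of_mem hx]; norm_num
    · rw [indicator_of_notMem hx]; norm_num
  have := abs_average_sub_average_le_of_coupling μ ν π B h1' h2' hB hBd (A.indicator 1)
    (measurable_const.indicator hA) hb
  rwa [average_eq_integral, average_eq_integral, integral_indicator_one hA, integral_indicator_one hA] at this

end Coupling

/-! ## §2 The converse door: summable conditioned increments ⇒ `OneStepCoupling` -/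

/-- The diagonal of the unit field space `SU(2)^{bonds} × SU(2)^{bonds}` is measurable (second countable Hausdorff, Borel). -/
theorem measurableSet_diagonal_unitSpace (F : T3Family) : MeasurableSet (diagonal (UnitSpace F)) := by
  haveI : SecondCountableTopology (Matrix (Fin 2) (Fin 2) ℂ) :=
    inferInstanceAs (SecondCountableTopology (Fin 2 → Fin 2 → ℂ))
  haveI : SecondCountableTopology (Matrix.specialUnitaryGroup (Fin 2) ℂ) :=
    Topology.IsEmbedding.subtypeVal.secondCountableTopology
  haveI : SecondCountableTopology (UnitSpace F) :=
    inferInstanceAs (SecondCountableTopology (PBond (F.P 0) 0 → Matrix.specialUnitaryGroup (Fin 2) ℂ))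
  haveI : BorelSpace (UnitSpace F) :=
    inferInstanceAs (BorelSpace (PBond (F.P 0) 0 → Matrix.specialUnitaryGroup (Fin 2) ℂ))
  haveI : T2Space (UnitSpace F) :=
    inferInstanceAs (T2Space (PBond (F.P 0) 0 → Matrix.specialUnitaryGroup (Fin 2) ℂ))
  exact measurableSet_diagonal

/-- The route's window average is the integral against the conditioned unit law (definitional). -/
theorem average_windowUnitLaw (F : T3Family) (γ b₀ p₀ : ℝ) (K : ℕ) (W : UnitSpace F → ℝ) :
    (⨍ u, W u ∂windowUnitLaw F γ b₀ p₀ K) = ∫ u, W u ∂condUnitLaw F γ b₀ p₀ K := by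
  rw [average_eq']
  rfl

/-- ★★ **THE CONVERSE DOOR.**  The v1 «via-tv» increment form — for small `γ`, summable `t` with
`|⨍ W ∂win_{K+1} − ⨍ W ∂win_K| ≤ t_K` for every measurable unit observable `|W| ≤ 1` — implies `OneStepCoupling` with the SAME
`t`: shrink `γ₁` below the junk guard of p636825 (the conditioned laws are probability laws), then couple `ν_K`, `ν_{K+1}`
maximally (§1) with bad set the off-diagonal. -/
theorem oneStepCoupling_of_summableCondIncrements
    (h : ∀ (L : ℕ) (b₀ p₀ : ℝ), 0 < b₀ → 2 < p₀ → ∃ γ₁ : ℝ, 0 < γ₁ ∧ ∀ (F : T3Family) (γ : ℝ), F.L = L → 0 < γ →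
      γ ≤ γ₁ → ∃ t : ℕ → ℝ, Summable t ∧
        ∀ (K : ℕ) (W : GaugeField (F.P 0) 0 (Matrix.specialUnitaryGroup (Fin 2) ℂ) → ℝ), Measurable W →
          (∀ u, |W u| ≤ 1) →
          |(⨍ u, W u ∂Measure.map (unitA F ℰp (K + 1))
              ((gibbsK F ℰp γ (K + 1)).restrict (histGood F ℰp (θBal F.L γ b₀ p₀) (K + 1) 0))) -
            ⨍ u, W u ∂Measure.map (unitA F ℰp K)
              ((gibbsK F ℰp γ K).restrict (histGood F ℰp (θBal F.L γ b₀ p₀) K 0))| ≤ t K) :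
    OneStepCoupling := by
  intro L b₀ p₀ hb₀ hp₀
  obtain ⟨γ₁, hγ₁, hF⟩ := h L b₀ p₀ hb₀ hp₀
  obtain ⟨γ₂, hγ₂, -, hP⟩ := isProbabilityMeasure_condUnitLaw L b₀ p₀ hb₀ hp₀
  refine ⟨min γ₁ γ₂, lt_min hγ₁ hγ₂, fun F γ hFL hγ hγγ => ?_⟩
  obtain ⟨t, ht, hK⟩ := hF F γ hFL hγ (hγγ.trans (min_le_left _ _))
  refine ⟨t, ht, fun K => ?_⟩
  haveI := hP F γ hFL hγ (hγγ.trans (min_le_right _ _)) K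
  haveI := hP F γ hFL hγ (hγγ.trans (min_le_right _ _)) (K + 1)
  have hΔ := measurableSet_diagonal_unitSpace F
  have hW : ∀ W : UnitSpace F → ℝ, Measurable W → (∀ x, |W x| ≤ 1) →
      |(∫ x, W x ∂condUnitLaw F γ b₀ p₀ (K + 1)) - ∫ x, W x ∂condUnitLaw F γ b₀ p₀ K| ≤ t K := by
    intro W hWm hWb
    rw [← average_windowUnitLaw, ← average_windowUnitLaw]
    exact hK K W hWm hWb
  obtain ⟨π, hπ, h1, h2, hoff⟩ :=
    exists_coupling_of_integral_bound hΔ (condUnitLaw F γ b₀ p₀ K) (condUnitLaw F γ b₀ p₀ (K + 1)) hW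
  exact ⟨π, (diagonal (UnitSpace F))ᶜ, hπ, h1, h2, hΔ.compl,
    fun p hp => mem_diagonal_iff.1 (notMem_compl_iff.1 hp), hoff⟩

/-- ★★ **`OneStepCoupling` ⟺ SUMMABLE CONDITIONED INCREMENTS** — the coupling door of «via-tv» v2 and the increment door of v1 are
the same statement (⇒: p635469's `summableCondIncrements_of_oneStepCoupling`; ⇐: maximal coupling). -/
theorem oneStepCoupling_iff_summableCondIncrements :
    OneStepCoupling ↔
      ∀ (L : ℕ) (b₀ p₀ : ℝ), 0 < b₀ → 2 < p₀ → ∃ γ₁ : ℝ, 0 < γ₁ ∧ ∀ (F : T3Family) (γ : ℝ), F.L = L → 0 < γ →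
        γ ≤ γ₁ → ∃ t : ℕ → ℝ, Summable t ∧
          ∀ (K : ℕ) (W : GaugeField (F.P 0) 0 (Matrix.specialUnitaryGroup (Fin 2) ℂ) → ℝ), Measurable W →
            (∀ u, |W u| ≤ 1) →
            |(⨍ u, W u ∂Measure.map (unitA F ℰp (K + 1))
                ((gibbsK F ℰp γ (K + 1)).restrict (histGood F ℰp (θBal F.L γ b₀ p₀) (K + 1) 0))) -
              ⨍ u, W u ∂Measure.map (unitA F ℰp K)
                ((gibbsK F ℰp γ K).restrict (histGood F ℰp (θBal F.L γ b₀ p₀) K 0))| ≤ t K :=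
  ⟨summableCondIncrements_of_oneStepCoupling, oneStepCoupling_of_summableCondIncrements⟩

/-! ## §3 The event currency: summable total-variation increments of the conditioned unit laws -/

/-- ★★ **`OneStepCoupling` ⟺ SUMMABLE EVENT INCREMENTS OF THE CONDITIONED UNIT LAWS**: for small `γ`, a summable `t` with
`|ν_{K+1}(A) − ν_K(A)| ≤ t_K` for every measurable unit event `A` (`ν_K = condUnitLaw … K`).  ⇒: a coupling's bad mass bounds
every event increment (`abs_measureReal_sub_le_of_coupling`); ⇐: the junk guard (p636825) and the maximal coupling (§1), with
`t ↦ 2t`.  This is the plain total-variation currency a supplier of the RG content may use instead of couplings. -/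
theorem oneStepCoupling_iff_summableEventIncrements :
    OneStepCoupling ↔
      ∀ (L : ℕ) (b₀ p₀ : ℝ), 0 < b₀ → 2 < p₀ → ∃ γ₁ : ℝ, 0 < γ₁ ∧ ∀ (F : T3Family) (γ : ℝ), F.L = L → 0 < γ →
        γ ≤ γ₁ → ∃ t : ℕ → ℝ, Summable t ∧ ∀ (K : ℕ) (A : Set (UnitSpace F)), MeasurableSet A →
          |(condUnitLaw F γ b₀ p₀ (K + 1)).real A - (condUnitLaw F γ b₀ p₀ K).real A| ≤ t K := by
  constructor
  · intro h L b₀ p₀ hb₀ hp₀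
    obtain ⟨γ₁, hγ₁, hF⟩ := h L b₀ p₀ hb₀ hp₀
    refine ⟨γ₁, hγ₁, fun F γ hFL hγ hγγ => ?_⟩
    obtain ⟨t, ht, hK⟩ := hF F γ hFL hγ hγγ
    refine ⟨t, ht, fun K A hA => ?_⟩
    obtain ⟨π, B, hπ, h1, h2, hB, hBd, hBt⟩ := hK K
    haveI : IsProbabilityMeasure (condUnitLaw F γ b₀ p₀ K) := by
      rw [← h1]; exact Measure.isProbabilityMeasure_map measurable_fst.aemeasurable
    haveI : IsProbabilityMeasure (condUnitLaw F γ b₀ p₀ (K + 1)) := by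
      rw [← h2]; exact Measure.isProbabilityMeasure_map measurable_snd.aemeasurable
    have := abs_measureReal_sub_le_of_coupling _ _ π B h1 h2 hB hBd hA
    linarith
  · intro h L b₀ p₀ hb₀ hp₀
    obtain ⟨γ₁, hγ₁, hF⟩ := h L b₀ p₀ hb₀ hp₀
    obtain ⟨γ₂, hγ₂, -, hP⟩ := isProbabilityMeasure_condUnitLaw L b₀ p₀ hb₀ hp₀
    refine ⟨min γ₁ γ₂, lt_min hγ₁ hγ₂, fun F γ hFL hγ hγγ => ?_⟩
    obtain ⟨t, ht, hK⟩ := hF F γ hFL hγ (hγγ.trans (min_le_left _ _))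
    refine ⟨fun K => 2 * t K, ht.mul_left 2, fun K => ?_⟩
    haveI := hP F γ hFL hγ (hγγ.trans (min_le_right _ _)) K
    haveI := hP F γ hFL hγ (hγγ.trans (min_le_right _ _)) (K + 1)
    have hΔ := measurableSet_diagonal_unitSpace F
    have hA : ∀ A : Set (UnitSpace F), MeasurableSet A →
        (condUnitLaw F γ b₀ p₀ K).real A - (condUnitLaw F γ b₀ p₀ (K + 1)).real A ≤ t K := by
      intro A hA
      have := hK K A hA
      rw [abs_le] at this
      linarith [this.1]
    obtain ⟨π, hπ, h1, h2, hoff⟩ :=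
      exists_coupling_of_measureReal_sub_le hΔ (condUnitLaw F γ b₀ p₀ K) (condUnitLaw F γ b₀ p₀ (K + 1)) hA
    refine ⟨π, (diagonal (UnitSpace F))ᶜ, hπ, h1, h2, hΔ.compl,
      fun p hp => mem_diagonal_iff.1 (notMem_compl_iff.1 hp), ?_⟩
    show (π (diagonal (UnitSpace F))ᶜ).toReal ≤ 2 * t K / 2
    linarith

/-! ## §4 The door lattice: crux r2 (`AllHeightsSmallTilt`, «via-tilt») ⇒ `OneStepCoupling` («via-tv») -/

/-- **TILT ⇒ INCREMENTS**: the all-heights unit tilt of summable radii `r_K` (crux r2) gives the v1 increment form with `t_K = 8 r_K`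
(the landed `abs_integral_normalize_sub_le_of_isTilt`; the window laws are non-zero in the junk-guard range of p636825). -/
theorem summableCondIncrements_of_allHeightsSmallTilt
    (hT : Summit.QuantumFields.YangMills.Theses.SmallFieldWidening.AllHeightsSmallTilt) :
    ∀ (L : ℕ) (b₀ p₀ : ℝ), 0 < b₀ → 2 < p₀ → ∃ γ₁ : ℝ, 0 < γ₁ ∧ ∀ (F : T3Family) (γ : ℝ), F.L = L → 0 < γ →
      γ ≤ γ₁ → ∃ t : ℕ → ℝ, Summable t ∧
        ∀ (K : ℕ) (W : GaugeField (F.P 0) 0 (Matrix.specialUnitaryGroup (Fin 2) ℂ) → ℝ), Measurable W →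
          (∀ u, |W u| ≤ 1) →
          |(⨍ u, W u ∂Measure.map (unitA F ℰp (K + 1))
              ((gibbsK F ℰp γ (K + 1)).restrict (histGood F ℰp (θBal F.L γ b₀ p₀) (K + 1) 0))) -
            ⨍ u, W u ∂Measure.map (unitA F ℰp K)
              ((gibbsK F ℰp γ K).restrict (histGood F ℰp (θBal F.L γ b₀ p₀) K 0))| ≤ t K := by
  intro L b₀ p₀ hb₀ hp₀
  obtain ⟨γ₁, hγ₁, hF⟩ := hT L b₀ p₀ hb₀ hp₀
  obtain ⟨γ₂, hγ₂, -, hP⟩ := windowUnitLaw_univ_pos L b₀ p₀ hb₀ hp₀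
  refine ⟨min γ₁ γ₂, lt_min hγ₁ hγ₂, fun F γ hFL hγ hγγ => ?_⟩
  obtain ⟨r, hr, ht⟩ := hF F γ hFL hγ (hγγ.trans (min_le_left _ _))
  refine ⟨fun K => 8 * r K, hr.mul_left 8, fun K W hWm hW => ?_⟩
  have hne : ∀ j, NeZero (windowUnitLaw F γ b₀ p₀ j) := fun j =>
    ⟨fun h0 => by
      have hpos := (hP F γ hFL hγ (hγγ.trans (min_le_right _ _)) j).1
      rw [h0, Measure.coe_zero, Pi.zero_apply] at hpos
      exact lt_irrefl _ hpos⟩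
  haveI := hne K
  haveI := hne (K + 1)
  haveI := isFiniteMeasure_windowUnitLaw F hγ.le b₀ p₀ K
  haveI := isFiniteMeasure_windowUnitLaw F hγ.le b₀ p₀ (K + 1)
  have htK : IsTilt (windowUnitLaw F γ b₀ p₀ K) (windowUnitLaw F γ b₀ p₀ (K + 1)) (r K) := by
    have h' := ht K
    simp only [Nat.div_zero] at h'
    exact h'
  show |(⨍ u, W u ∂windowUnitLaw F γ b₀ p₀ (K + 1)) - ⨍ u, W u ∂windowUnitLaw F γ b₀ p₀ K| ≤ 8 * r K
  rw [average_eq', average_eq']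
  exact abs_integral_normalize_sub_le_of_isTilt htK hWm hW

/-- ★ **THE DOOR LATTICE**: crux r2 `AllHeightsSmallTilt` (the registered stub of «via-tilt») implies `OneStepCoupling` (the registered
stub of «via-tv»); with `windowCondCauchy_of_oneStepCoupling` (p635469): `AllHeightsSmallTilt ⇒ OneStepCoupling ⇒ WindowCondCauchy`. -/
theorem oneStepCoupling_of_allHeightsSmallTilt
    (hT : Summit.QuantumFields.YangMills.Theses.SmallFieldWidening.AllHeightsSmallTilt) : OneStepCoupling :=
  oneStepCoupling_of_summableCondIncrements (summableCondIncrements_of_allHeightsSmallTilt hT)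

end Summit.QuantumFields.YangMills.Theorems.WindowCondCauchyCoupling
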